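import Summits.QuantumFields.YangMills.Theorems.BalabanLadderIRPinnedExitCofinal
import Summits.QuantumFields.YangMills.Theorems.BalabanLadderIRRankPurityCofinalDefs
import Summits.QuantumFields.YangMills.Theses.BalabanLadder
import HarnessLib

/-!
# Crux `IRcof` (stmt-QuantumFields-26930, the Leg's RE-TYPED infrared leaf, R423 ∕ R424 (a)) — BILL OF RECORD CANDIDATE
# `pinned-cofinal` rev 2: `IRcof ⇐ PXcof(1∕24) ∧ N_cof` — two obligations, X-free, sign-free, cofinal, both `π₁`-conjunct-minimal

Thin registered-skeleton form (LEAD prover ym-ir-line-ab-p1; OWNER ym-beyond-p2 g33 08:30:59Z: «the LEAD's cut has precedence;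
a registered skeleton on 26930 must conclude `Summit.QuantumFields.YangMills.Theses.BalabanLadder.IRcof` LITERALLY») of idea-11's
LINE 3 `pinned-exit-cofinal` (`Cruxes/IR/Lines/pinned_exit_cofinal.lean` 722ac85c6982; critics: crit-1 g2 VERDICT 21 PASS-WITH-PRICE as the
X-free cofinal re-cut, crit-3 g2 08:25:00Z PRICE {PXcof(1∕24)} + structural PASS, crit-4 g3 CONCUR).  No mathematics lives here: the
composition is the LANDED X-free cofinal kernel `PinnedExitCofinal.cofinalGapOn_of_pinnedExits` (`Theorems/BalabanLadderIRPinnedExitCofinal.lean`,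
p616292, idea-11) for simply-connected `G`, and on the `π₁ ≠ 1` side the stub IS the leaf's necessary conjunct N_cof = `RankPurity.IRnscCof`
(idea-14's LANDED def, `Theorems/BalabanLadderIRRankPurityCofinalDefs.lean` p622200; kernel fact `IRcof ↔ IRscCof ∧ IRnscCof`, critics crit-1 V23 ∕ crit-4 T3).
Rev 1 (26ebe475d942) had N = `ColdPressurePincer.IRnsc` there (sufficient only: N ⇒ N_cof); the re-cut N ↦ N_cof was recommended by crit-1∕crit-4,
GO crit-3 09:41:49Z, pre-announced 09:40:31Z.

STUBS (two):
* `stub_pinnedExitsCofinal : PinnedExitsCofinalAt (1/24)` — **PXcof(1∕24), THE NUMBER (cofinal, pinned in floor units)**: for every compact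
  simple simply-connected `G`, every `r`, every positive unit map `a → 0` carrying IRcof's own floor `LowerBounds G r a`, there is `T` such that
  for every `β₁` SOME coupling `β ≥ β₁` has ONE cold `4:1` torus, `8 ≤ L`, `a(β)·L ≤ T`, with `coldDefect r.ρ β L ≤ 1∕24` (purity ≥ 23∕24).
  Width 0 (E-type Yang–Mills content; false for `U(1)₄`).  Weaker than the 19354 slot's PX (`PinnedExit96.PinnedExitAt (1/24)`, ALL large β):
  `PinnedExitCofinal.pinnedExitsCofinal_of_pinnedExitAt`.
* `stub_irnscCof : RankPurity.IRnscCof` — **N_cof**, the NECESSARY `π₁ ≠ 1` conjunct of the leaf (the cofinal `GapInUnits` clustering family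
  for compact simple `G` with `π₁(G) ≠ 1`, under the same floor); weaker by name than the residual of record N = `ColdPressurePincer.IRnsc`.

ONE crux-headed theorem only (`IRcof_of_stubs`; the hypothesis-carrying composition is `IRcof_of : Bill` behind a `def`) — the skeleton
checker analyses the first crux-headed theorem it meets.
HONEST FRAMING: nothing here proves the Yang–Mills mass gap (Clay), `IRcof`, `IR`, or any leg; the two stubs carry ALL the content;
R4 closes only the conditional finite-𝕋⁴ rung `BalabanLadder.UV`.
-/

set_option autoImplicit false

noncomputable section

open Filter Topology MeasureTheory
open Literature.MathematicalPhysics.QuantumFieldTheory Literature.MathematicalPhysics.QuantumLattice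
open Summit.QuantumFields.YangMills.Cruxes.OSLegsFromFemtoAndGap.DlrCollarTransfer (LowerBounds)
open Summit.QuantumFields.YangMills.Cruxes.IR.ColdPurityBridge (coldDefect)
open Summit.QuantumFields.YangMills.Cruxes.IR.RankPurity (IRnscCof)
open Summit.QuantumFields.YangMills.Cruxes.IR.PinnedExitCofinal (cofinalGapOn_of_pinnedExits)

namespace Summit.QuantumFields.YangMills.Cruxes.IRcof.PinnedCofinalBill

/-! ## §1 The one new obligation, typed (verbatim idea-11's `PinnedExitCofinalLine.PinnedExitsCofinalAt`) -/

/-- **PXcof(θ) = `PinnedExitsCofinalAt θ`**: for simply-connected compact simple `G`, every `r`, every positive unit map `a → 0` carrying the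
floor `LowerBounds G r a`: there is `T` such that for every `β₁` some coupling `β ≥ β₁` has ONE cold `4:1` torus of half-side `L ≥ 8` with
`a(β)·L ≤ T` and purity defect `coldDefect r.ρ β L ≤ θ`. -/
def PinnedExitsCofinalAt (θ : ℝ) : Prop :=
  ∀ (G : Type) [Group G] [TopologicalSpace G] [IsTopologicalGroup G] [CompactSpace G],
    IsCompactSimpleLieGroup G → SimplyConnectedSpace G →
    letI : MeasurableSpace G := borel G
    haveI : BorelSpace G := ⟨rfl⟩
    ∀ (r : LatticeRep G) (a : ℝ → ℝ), (∀ β, 0 < a β) → Tendsto a atTop (𝓝 0) → LowerBounds G r a →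
      ∃ T : ℝ, ∀ β₁ : ℝ, ∃ β : ℝ, β₁ ≤ β ∧ ∃ L : ℕ, 8 ≤ L ∧ a β * (L : ℝ) ≤ T ∧ coldDefect r.ρ β L ≤ θ

/-! ## §2 Stubs (sorries ONLY here) -/

/-- **stub PXcof(1∕24)** — one pinned `1∕24`-pure cold `4:1` box at cofinally many couplings (load-bearing; THE NUMBER). -/
theorem stub_pinnedExitsCofinal : PinnedExitsCofinalAt (1 / 24) := by
  sorry

/-- **stub N_cof** — the NECESSARY `π₁(G) ≠ 1` conjunct of the leaf BY NAME (`RankPurity.IRnscCof`, idea-14's landed def; weaker than `IRnsc`). -/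
theorem stub_irnscCof : IRnscCof := by
  sorry

/-! ## §3 Composition: the route decl BY NAME over the landed kernel -/

/-- The bill as ONE proposition (behind a `def`, so that `IRcof_of_stubs` is the file's only crux-headed theorem). -/
def Bill : Prop := PinnedExitsCofinalAt (1 / 24) → IRnscCof → Summit.QuantumFields.YangMills.Theses.BalabanLadder.IRcof

/-- **The bill holds: `PXcof(1∕24) → N_cof → IRcof` (PROVED composition, stub-free).**  Simply-connected `G`: the landed X-free cofinal kernel
`PinnedExitCofinal.cofinalGapOn_of_pinnedExits`; `π₁(G) ≠ 1`: N_cof is that conjunct verbatim.  Apply as `IRcof_of hP hN` (the `def Bill` unfolds). -/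
theorem IRcof_of : Bill := by
  intro hP hN G _ _ _ _ hG
  letI : MeasurableSpace G := borel G
  haveI : BorelSpace G := ⟨rfl⟩
  intro r a ha ha0 hlb
  by_cases hsc : SimplyConnectedSpace G
  · obtain ⟨T, hcof⟩ := hP G hG hsc r a ha ha0 hlb
    exact cofinalGapOn_of_pinnedExits r a ha ha0 hcof
  · exact hN G hG hsc r a ha ha0 hlb

/-- **`IRcof` (the route's decl, literally) from the two registered stubs.** -/
theorem IRcof_of_stubs : Summit.QuantumFields.YangMills.Theses.BalabanLadder.IRcof :=
  IRcof_of stub_pinnedExitsCofinal stub_irnscCof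

end Summit.QuantumFields.YangMills.Cruxes.IRcof.PinnedCofinalBill

end
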